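import Mathlib
import Literature.AlgebraicGeometry.CossartPiltant200819.Thm15iBaseSidePhase2019
import Summits.ResolutionOfSingularities.ResolutionOfSingularities.Theorems.RadicialJungCleanModelsCleanLU3DimThreeCentre
import Literature.AlgebraicGeometry.Resolution.LocalBlowup
import Literature.AlgebraicGeometry.Resolution.ExcellentRings
import Literature.AlgebraicGeometry.Resolution.ExcellentRingsEssFiniteType
import Literature.AlgebraicGeometry.Resolution.ExcellentRingsFieldProofs
import Literature.AlgebraicGeometry.Resolution.TranscendenceDefect
import HarnessLib

/-!
# Route `RadicialJung`, crux `CleanModels` (stmt-15917): the `p = 2` slice of the node `cleanLU3` from Cossart–Piltant 2019 Thm. 1.5 (i) base-side — part 1/2: the end state of the printed phase on a finitely generated model (source §1)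

PORT (line lead `res-B-lead-1` g8, for Sketch rev 33) of res-B-lens-5 g18's PORT-READY, DEF-FREE crux workfile
`Cruxes/DescentPerfectToAll/Lens5_PTwo_CP2019BaseSide.lean` rev 2 (crux file sha16 5f3748133628e111; crit-1 TRIAGE-154 / 154b PASS; re-certified against
Sketch rev 32 by res-B-lens-5 g19), split into two modules; declarations VERBATIM, namespace unchanged
(`Summit.ResolutionOfSingularities.ResolutionOfSingularities.Theorems.RadicialJung.CleanModels.Lens5.PTwo`).  CONTENT: the `p = 2` SLICE of the node
`cleanLU3` of `Cruxes/CleanModels/Lines/Sketch.lean` (every valuation ring, every ground field of characteristic `2`), KERNEL-CLOSED modulo the typed printed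
theorem Cossart–Piltant 2019 Thm. 1.5 (i) read base-side (`Literature.AlgebraicGeometry.CossartPiltant200819.CossartPiltant2019_thm_1_5_i_baseSidePhase`,
INPUTS wi-91399), carried BY NAME (`hBS`) or through its `p = 2` instance (`hBS2`): at `p = 2` the printed end state «multiplicity `< p`» reads
«`g_n - c² ∉ 𝔪²` for every `c`», which is loose cleanness (form (2) or (3)) on the last regular local ring of the base-side tower, a finitely generated
model by Novacoski–Spivakovsky bookkeeping.  OURS · counted 0 · nothing here proves resolution in characteristic `p`; nothing is claimed about `p ≥ 3`.
This module: `exists_lowMultModel_of_baseSidePhaseAt`, `exists_lowMultModel_of_cp2019BaseSidePhase`, `baseSidePhaseTwo_of_cp2019` (source :80–270).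
-/

noncomputable section

set_option linter.dupNamespace false

open IsLocalRing Polynomial
open Literature.AlgebraicGeometry.Resolution
open Literature.AlgebraicGeometry.CossartPiltant200819
open Summit.ResolutionOfSingularities.ResolutionOfSingularities.Theorems

namespace Summit.ResolutionOfSingularities.ResolutionOfSingularities.Theorems.RadicialJung.CleanModels.Lens5.PTwo


/-! ## §1 The end state of the printed phase on a finitely generated model (every `p`) -/

/-- **The END STATE of Cossart–Piltant's base-side phase, in the customer's currency (every prime `p`).**  From the printed
theorem `CossartPiltant2019_thm_1_5_i_baseSidePhase` at a 3-dimensional regular centre of a finitely generated model `A ⊆ O` of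
`K` over a field `k` of characteristic `p`, for `g₀ ∈ K ∖ K^p`: a finitely generated enlargement `A ⊆ A' ⊆ O` (`A' = A[t]`, `t`
the chart generators of the printed tower), still with fraction field `K`, REGULAR at the centre of `O` (its local ring there is
Cossart–Piltant's `B_n`), carrying a representative `C^p g₀ + D^p` (`C ≠ 0`) of the `K^p`-line of `g₀` of multiplicity `< p`:
`(C^p g₀ + D^p) - c^p ∉ 𝔪^p` for every `c` in that local ring.  Plumbing verbatim that of ✓ `cleanLU_of_frame_of_dimThreeCentre`.
[cite: CossartPiltant2019, Thm. 1.5 (i) pp. 271–272; Cor. 5.6 p. 405; Prop. 2.22 (2.17)/(2.18) pp. 294–295] -/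
theorem exists_lowMultModel_of_baseSidePhaseAt (p : ℕ) (hp : p.Prime)
    (hBSp : (∀ (S : Type) [CommRing S] [IsRegularLocalRing S],
          IsExcellentRing S → ringKrullDim S = 3 → CharP S p →
          ∀ (K : Type) [Field K] [Algebra S K] [IsFractionRing S K] (f : S),
          (∀ c : K, c ^ p ≠ algebraMap S K f) →
          ∀ (O : ValuationSubring K), (algebraMap S K).range ≤ O.toSubring →
          (∀ s ∈ IsLocalRing.maximalIdeal S, O.valuation (algebraMap S K s) < 1) →
          ∃ (n : ℕ) (B : ℕ → Subring K) (g : ℕ → K),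
          B 0 = locAtCentre (algebraMap S K).range O ∧ g 0 = algebraMap S K f ∧
          (∀ i ≤ n, B i ≤ O.toSubring ∧ IsRegularLocalRing (B i) ∧ g i ∈ B i) ∧
          (∀ i < n, ∃ P : Ideal (B i), IsRegularLocalRing ((B i) ⧸ P) ∧
            IsLocalBlowupAlong O (B i) P (B (i + 1)) ∧
            ∃ c d : K, c ≠ 0 ∧ g (i + 1) = c ^ p * g i + d ^ p) ∧
          ∀ (hg : g n ∈ B n) (_hBn : IsRegularLocalRing (B n)) (c : B n),
            (⟨g n, hg⟩ : B n) - c ^ p ∉ IsLocalRing.maximalIdeal (B n) ^ p))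
    (k : Type) [Field k] [CharP k p] (K : Type) [Field K] [Algebra k K]
    (O : ValuationSubring K) (A : Subalgebra k K) (hAO : A.toSubring ≤ O.toSubring) (hAfg : A.FG)
    (hfrac : IsFractionRing A K) (hreg : IsRegularLocalRing (locAtCentre A.toSubring O))
    (hdim3 : ringKrullDim (locAtCentre A.toSubring O) = 3) (g₀ : K) (hg₀ : ∀ c : K, c ^ p ≠ g₀) :
    ∃ (A' : Subalgebra k K) (_ : A'.toSubring ≤ O.toSubring) (_ : A ≤ A') (_ : A'.FG) (_ : IsFractionRing A' K)
      (_ : IsRegularLocalRing (locAtCentre A'.toSubring O))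
      (C D : K) (hG : C ^ p * g₀ + D ^ p ∈ locAtCentre A'.toSubring O), C ≠ 0 ∧
        ∀ c : ↥(locAtCentre A'.toSubring O),
          (⟨C ^ p * g₀ + D ^ p, hG⟩ : ↥(locAtCentre A'.toSubring O)) - c ^ p ∉
            IsLocalRing.maximalIdeal ↥(locAtCentre A'.toSubring O) ^ p := by
  classical
  haveI : Fact p.Prime := ⟨hp⟩
  haveI := hreg
  set S : Subring K := locAtCentre A.toSubring O with hSdef
  have hSO : S ≤ O.toSubring := locAtCentre_le hAO
  have hAS : A.toSubring ≤ S := le_locAtCentre A.toSubring O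
  -- characteristic
  haveI : CharP K p := charP_of_injective_algebraMap (algebraMap k K).injective p
  haveI hSp : CharP S p := (S.subtype).charP Subtype.val_injective p
  -- `S` is excellent: a localisation of the finitely generated `k`-algebra `A`
  haveI : Algebra.FiniteType k A := (Subalgebra.fg_iff_finiteType A).mp hAfg
  have hexcA : IsExcellentRing A := isExcellentRing_of_finiteType_field k A
  haveI := isLocalization_locAtCentre (K := K) (O := O) hAO
  have hexcS : IsExcellentRing S :=
    IsExcellentRing.of_isLocalization (A := A.toSubring) (B := S) (subringCentre A.toSubring O hAO).primeCompl hexcA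
  -- `K = Frac S`
  haveI : IsFractionRing S K := by
    refine IsFractionRing.of_field S K fun z => ?_
    obtain ⟨a, b, -, hab⟩ := IsFractionRing.div_surjective (A := A) z
    exact ⟨⟨a, hAS a.2⟩, ⟨b, hAS b.2⟩, hab.symm⟩
  -- the radicand moved into `A ⊆ S`: `g₀ = a / b`, `f = a b^{p-1} = b^p g₀`
  obtain ⟨a, b, hb, hab⟩ := IsFractionRing.div_surjective (A := A) g₀
  have hb0 : (b : K) ≠ 0 := by
    intro h
    have : (b : A) = 0 := Subtype.ext h
    exact (nonZeroDivisors.ne_zero hb) this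
  have hab' : g₀ = (a : K) / (b : K) := hab.symm
  set f : S := ⟨(a : K) * (b : K) ^ (p - 1), S.mul_mem (hAS a.2) (S.pow_mem (hAS b.2) _)⟩ with hfdef
  have hfK : ((f : S) : K) = (b : K) ^ p * g₀ := by
    rw [hfdef, hab']
    have : (b : K) ^ p = (b : K) ^ (p - 1) * b := by
      rw [← pow_succ, Nat.sub_add_cancel hp.one_lt.le]
    rw [this]
    field_simp
  have hfp : ∀ c : K, c ^ p ≠ algebraMap S K f := by
    intro c hc
    apply hg₀ (c / b)
    rw [div_pow, hc]
    change ((f : S) : K) / (b : K) ^ p = g₀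
    rw [hfK]
    field_simp
  -- domination
  have hrange : (algebraMap S K).range ≤ O.toSubring := by
    rintro _ ⟨s, rfl⟩
    exact hSO s.2
  have hdom : ∀ s ∈ IsLocalRing.maximalIdeal S, O.valuation (algebraMap S K s) < 1 := by
    intro s hs
    exact (mem_maximalIdeal_locAtCentre_iff hAO s).mp hs
  -- THE PRINTED PHASE (the named fact, at the prime `p`)
  obtain ⟨n, B, g, hB0, hg0, hBall, hstep, hend⟩ := hBSp S hexcS hdim3 hSp K f hfp O hrange hdom
  have hrangeS : (algebraMap S K).range = S := by
    ext x
    constructor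
    · rintro ⟨s, rfl⟩; exact s.2
    · intro hx; exact ⟨⟨x, hx⟩, rfl⟩
  have hB0' : B 0 = S := by rw [hB0, hrangeS, hSdef, locAtCentre_locAtCentre]
  -- the tower is a chain of local blowing ups; `B n` is the local ring at the centre of a finitely generated model
  obtain ⟨hT, hBnloc⟩ := reflTransGen_of_steps O B n (by rw [hB0', hSdef, locAtCentre_locAtCentre])
    (fun i hi => by obtain ⟨P, -, hP, -⟩ := hstep i hi; exact ⟨P, hP⟩)
  obtain ⟨-, t, htO, hBn⟩ := exists_eq_locAtCentre_of_reflTransGen (by rw [hB0']; exact hSO) hT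
  rw [hBnloc, hB0', hSdef, PfaffLine.locAtCentre_closure_locAtCentre_union] at hBn
  -- the finitely generated model `A' = A[t]`
  let A' : Subalgebra k K :=
    { Subring.closure ((A.toSubring : Set K) ∪ ↑t) with
      algebraMap_mem' := fun r => Subring.subset_closure (Or.inl (A.algebraMap_mem r)) }
  have hA'sub : A'.toSubring = Subring.closure ((A.toSubring : Set K) ∪ ↑t) := rfl
  have hAA' : A ≤ A' := fun x hx => Subring.subset_closure (Or.inl hx)
  have hA'O : A'.toSubring ≤ O.toSubring := by
    rw [hA'sub, Subring.closure_le]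
    rintro x (hx | hx)
    · exact hAO hx
    · exact htO hx
  have hA'fg : A'.FG := by
    obtain ⟨s₀, hs₀⟩ := hAfg
    refine ⟨s₀ ∪ t, le_antisymm ?_ ?_⟩
    · rw [Algebra.adjoin_le_iff]
      rintro x hx
      rw [Finset.coe_union] at hx
      rcases hx with hx | hx
      · exact hAA' (hs₀ ▸ Algebra.subset_adjoin hx)
      · exact Subring.subset_closure (Or.inr hx)
    · intro x hx
      change x ∈ Subring.closure ((A.toSubring : Set K) ∪ ↑t) at hx
      have hle : Subring.closure ((A.toSubring : Set K) ∪ ↑t) ≤ (Algebra.adjoin k (↑(s₀ ∪ t) : Set K)).toSubring := by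
        rw [Subring.closure_le]
        rintro y (hy | hy)
        · have : y ∈ Algebra.adjoin k (s₀ : Set K) := by rw [hs₀]; exact hy
          exact Algebra.adjoin_mono (by rw [Finset.coe_union]; exact Set.subset_union_left) this
        · exact Algebra.subset_adjoin (by rw [Finset.coe_union]; exact Or.inr hy)
      exact hle hx
  have hBnA' : B n = locAtCentre A'.toSubring O := by rw [hA'sub]; exact hBn
  have hfracA' : IsFractionRing A' K := by
    refine IsFractionRing.of_field A' K fun z => ?_
    obtain ⟨a₁, b₁, -, hab₁⟩ := IsFractionRing.div_surjective (A := A) z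
    exact ⟨⟨a₁, hAA' a₁.2⟩, ⟨b₁, hAA' b₁.2⟩, hab₁.symm⟩
  -- facts about `B n`
  obtain ⟨hBnO, hBnreg, hgn⟩ := hBall n le_rfl
  have hregA' : IsRegularLocalRing (locAtCentre A'.toSubring O) := by rw [← hBnA']; exact hBnreg
  -- `g n` in the `K^p`-line of `f`, hence of `g₀`
  obtain ⟨C, D, hC, hline⟩ := exists_line_of_tower p (algebraMap S K f) g hg0 n
    (fun i hi => by obtain ⟨-, -, -, hcd⟩ := hstep i hi; exact hcd)
  have hfK' : (algebraMap S K) f = (b : K) ^ p * g₀ := hfK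
  have hGeq : (C * (b : K)) ^ p * g₀ + D ^ p = g n := by
    rw [hline, hfK', mul_pow]; ring
  have hgn' : g n ∈ locAtCentre A'.toSubring O := by rw [← hBnA']; exact hgn
  have hGmem : (C * (b : K)) ^ p * g₀ + D ^ p ∈ locAtCentre A'.toSubring O := by rw [hGeq]; exact hgn'
  -- the end-state `m < p`, transported to the local ring of `A'` at the centre
  have hend' : ∀ (hg : g n ∈ locAtCentre A'.toSubring O) (_h : IsRegularLocalRing ↥(locAtCentre A'.toSubring O))
      (c : ↥(locAtCentre A'.toSubring O)),
      (⟨g n, hg⟩ : ↥(locAtCentre A'.toSubring O)) - c ^ p ∉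
        IsLocalRing.maximalIdeal ↥(locAtCentre A'.toSubring O) ^ p := by
    rw [← hBnA']; exact hend
  haveI := hregA'
  have hmultG : ∀ c : ↥(locAtCentre A'.toSubring O),
      (⟨(C * (b : K)) ^ p * g₀ + D ^ p, hGmem⟩ : ↥(locAtCentre A'.toSubring O)) - c ^ p ∉
        IsLocalRing.maximalIdeal ↥(locAtCentre A'.toSubring O) ^ p := by
    intro c
    have heq : (⟨(C * (b : K)) ^ p * g₀ + D ^ p, hGmem⟩ : ↥(locAtCentre A'.toSubring O)) = ⟨g n, hgn'⟩ :=
      Subtype.ext hGeq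
    rw [heq]
    exact hend' hgn' hregA' c
  exact ⟨A', hA'O, hAA', hA'fg, hfracA', hregA', C * (b : K), D, hGmem, mul_ne_zero hC hb0, hmultG⟩

/-- (rev-1 name, KEPT) the END STATE from the printed fact BY NAME, every `p`: `exists_lowMultModel_of_baseSidePhaseAt p hp (hBS p hp)`.
[cite: CossartPiltant2019, Thm. 1.5 (i) pp. 271–272; Cor. 5.6 p. 405; Prop. 2.22 (2.17)/(2.18) pp. 294–295] -/
theorem exists_lowMultModel_of_cp2019BaseSidePhase (hBS : CossartPiltant2019_thm_1_5_i_baseSidePhase.{0})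
    (p : ℕ) (hp : p.Prime)
    (k : Type) [Field k] [CharP k p] (K : Type) [Field K] [Algebra k K]
    (O : ValuationSubring K) (A : Subalgebra k K) (hAO : A.toSubring ≤ O.toSubring) (hAfg : A.FG)
    (hfrac : IsFractionRing A K) (hreg : IsRegularLocalRing (locAtCentre A.toSubring O))
    (hdim3 : ringKrullDim (locAtCentre A.toSubring O) = 3) (g₀ : K) (hg₀ : ∀ c : K, c ^ p ≠ g₀) :
    ∃ (A' : Subalgebra k K) (_ : A'.toSubring ≤ O.toSubring) (_ : A ≤ A') (_ : A'.FG) (_ : IsFractionRing A' K)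
      (_ : IsRegularLocalRing (locAtCentre A'.toSubring O))
      (C D : K) (hG : C ^ p * g₀ + D ^ p ∈ locAtCentre A'.toSubring O), C ≠ 0 ∧
        ∀ c : ↥(locAtCentre A'.toSubring O),
          (⟨C ^ p * g₀ + D ^ p, hG⟩ : ↥(locAtCentre A'.toSubring O)) - c ^ p ∉
            IsLocalRing.maximalIdeal ↥(locAtCentre A'.toSubring O) ^ p :=
  exists_lowMultModel_of_baseSidePhaseAt p hp (hBS p hp) k K O A hAO hAfg hfrac hreg hdim3 g₀ hg₀

/-- The `p = 2` instance of the printed fact (the proposed p = 2-specialised registered stub is exactly this type). -/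
theorem baseSidePhaseTwo_of_cp2019 (hBS : CossartPiltant2019_thm_1_5_i_baseSidePhase.{0}) :
    (∀ (S : Type) [CommRing S] [IsRegularLocalRing S],
          IsExcellentRing S → ringKrullDim S = 3 → CharP S 2 →
          ∀ (K : Type) [Field K] [Algebra S K] [IsFractionRing S K] (f : S),
          (∀ c : K, c ^ 2 ≠ algebraMap S K f) →
          ∀ (O : ValuationSubring K), (algebraMap S K).range ≤ O.toSubring →
          (∀ s ∈ IsLocalRing.maximalIdeal S, O.valuation (algebraMap S K s) < 1) →
          ∃ (n : ℕ) (B : ℕ → Subring K) (g : ℕ → K),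
          B 0 = locAtCentre (algebraMap S K).range O ∧ g 0 = algebraMap S K f ∧
          (∀ i ≤ n, B i ≤ O.toSubring ∧ IsRegularLocalRing (B i) ∧ g i ∈ B i) ∧
          (∀ i < n, ∃ P : Ideal (B i), IsRegularLocalRing ((B i) ⧸ P) ∧
            IsLocalBlowupAlong O (B i) P (B (i + 1)) ∧
            ∃ c d : K, c ≠ 0 ∧ g (i + 1) = c ^ 2 * g i + d ^ 2) ∧
          ∀ (hg : g n ∈ B n) (_hBn : IsRegularLocalRing (B n)) (c : B n),
            (⟨g n, hg⟩ : B n) - c ^ 2 ∉ IsLocalRing.maximalIdeal (B n) ^ 2) :=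
  hBS 2 Nat.prime_two


end Summit.ResolutionOfSingularities.ResolutionOfSingularities.Theorems.RadicialJung.CleanModels.Lens5.PTwo
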